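import Mathlib
import Summits.Ventures.PercRepro2.Graph
import Summits.Ventures.PercRepro2.Exploration
import Summits.Ventures.PercRepro2.Harris
import Summits.Ventures.PercRepro2.GibbsPAJoint
import Summits.Ventures.PercRepro2.SepClusterJoint
import Summits.Ventures.PercRepro2.SepClusterSupport
import Summits.Ventures.PercRepro2.SepClusterHarris
import Summits.Ventures.PercRepro2.SepFamJoint
import Summits.Ventures.PercRepro2.SepFamSupport
import Summits.Ventures.PercRepro2.SepFamHarris
import Summits.Ventures.PercRepro2.SepFamPA
import Summits.Ventures.PercRepro2.SepFamShrink

/-!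
# Conditional connection probabilities grow with the source (blind cell PercRepro2, p3 g12,
2026-08-27; `proofs/P3-G2.md` §5, corollary (MONO))

For disjoint families `Z, T, X` and a vertex `v` outside them, with `W = Z ∪ T`,
`W' = W ∪ {v}`:
  `P(W ↮ X) · P((Z ∪ {v}) ~ T ∧ W' ↮ X) ≥ P(Z ~ T ∧ W ↮ X) · P(W' ↮ X)`
(`sep_fam_mono`): the probability of `Z ~ T` conditioned on `Z ∪ T ↮ X` does not decrease when
a vertex is added to the source.  Proof: condition on the tuple of clusters of `X`; by the
domain-Markov identity the connection `Z ~ T` lives in the graph with the footprint removed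
(`prob_sepFam_inter_cross`), so `P(Z ~ T ∧ W ↮ X) = E[1_{W ↮ X} · φ(expl X)]` with
`φ(t) = P_{G − foot t}(Z ~ T)` antitone; (SHRINK) for `−φ` finishes.  Own work; standard axioms.
-/

namespace Summit.Ventures.PercRepro2

namespace SepPA

open Finset Classical

section FamilyMono

variable {V : Type*} {E : Type*} [Fintype V] [Fintype E] [DecidableEq E]
variable (ends : E → Sym2 V) (p : E → ℝ)

/-- The probability that `Z` is joined to `T` in the graph with the edges touching `foot t`
removed. -/
noncomputable def crossAway (Z T : Finset V) {X : Finset V} (t : X → Set V) : ℝ :=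
  prob p {ω | ∃ a ∈ Z, ∃ b ∈ T, Conn ends (restrict (touches ends (foot t))ᶜ ω) a b}

omit [Fintype V] [Fintype E] [DecidableEq E] in
/-- On `{expl X = t}` with `Z ∪ T` outside the footprint, `Z ~ T` iff `Z ~ T` away from the
footprint. -/
lemma explEvent_inter_cross {Z T X : Finset V} {t : X → Set V}
    (hW : ∀ w ∈ Z ∪ T, w ∉ foot t) :
    explEvent ends X t ∩ crossEvent ends (Z : Set V) (T : Set V) =
      explEvent ends X t ∩
        {ω | ∃ a ∈ Z, ∃ b ∈ T, Conn ends (restrict (touches ends (foot t))ᶜ ω) a b} := by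
  ext ω
  simp only [Set.mem_inter_iff, crossEvent, Set.mem_setOf_eq, Finset.mem_coe]
  constructor
  · rintro ⟨ht, a, ha, b, hb, hc⟩
    refine ⟨ht, a, ha, b, hb, ?_⟩
    exact (conn_restrict_iff_of_closed (fun x hx y hxy => foot_closed ht hx hxy)
      (hW a (Finset.mem_union_left T ha))).mpr hc
  · rintro ⟨ht, a, ha, b, hb, hc⟩
    refine ⟨ht, a, ha, b, hb, ?_⟩
    exact (conn_restrict_iff_of_closed (fun x hx y hxy => foot_closed ht hx hxy)
      (hW a (Finset.mem_union_left T ha))).mp hc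

omit [Fintype V] in
/-- Domain Markov for a crossing: `P(expl X = t, Z ~ T) = P(expl X = t) · crossAway Z T t`. -/
lemma prob_explEvent_inter_cross {Z T X : Finset V} {t : X → Set V}
    (hW : ∀ w ∈ Z ∪ T, w ∉ foot t) :
    prob p (explEvent ends X t ∩ crossEvent ends (Z : Set V) (T : Set V)) =
      prob p (explEvent ends X t) * crossAway ends p Z T t := by
  rw [explEvent_inter_cross ends hW]
  unfold crossAway
  exact prob_inter_eq_mul_of_dependsOn p disjoint_compl_right (dependsOn_explEvent X t)
    (dependsOn_restrict (touches ends (foot t))ᶜ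
      fun ω' => ∃ a ∈ Z, ∃ b ∈ T, Conn ends ω' a b)

omit [Fintype V] in
/-- `crossAway` is antitone in the tuple. -/
lemma antitone_crossAway (hp01 : ∀ e, 0 < p e ∧ p e < 1) (Z T : Finset V) {X : Finset V} :
    Antitone (fun t : X → Set V => crossAway ends p Z T t) := by
  intro t t' h
  unfold crossAway
  apply prob_mono (isProbVec_of_interior p hp01)
  rintro ω ⟨a, ha, b, hb, hc⟩
  refine ⟨a, ha, b, hb, ?_⟩
  exact conn_mono (restrict_le_restrict_of_subset
    (Set.compl_subset_compl.mpr (touches_mono ends (foot_mono h))) ω) hc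

/-- `P(Z ~ T ∧ W ↮ X) = E[1_{W ↮ X} · crossAway Z T (expl X)]` for `Z ∪ T ⊆ W`. -/
lemma prob_sepFam_inter_cross (Z T W X : Finset V) (hZT : Z ∪ T ⊆ W) :
    prob p (sepFam ends W X ∩ crossEvent ends (Z : Set V) (T : Set V)) =
      expect p (fun ω => (sepFam ends W X).indicator (fun _ => (1 : ℝ)) ω *
        crossAway ends p Z T (expl ends ω X)) := by
  rw [expect_indicator_comp_eq_sum p (sepFam ends W X) (fun ω => expl ends ω X)
    (crossAway ends p Z T)]
  rw [prob_eq_sum_prob_inter p (sepFam ends W X ∩ crossEvent ends (Z : Set V) (T : Set V))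
    (fun ω => expl ends ω X)]
  apply Finset.sum_congr rfl
  intro t _
  rw [Set.inter_comm (sepFam ends W X) {ω | expl ends ω X = t}, ← explEvent_eq_preimage]
  by_cases hW : ∀ w ∈ W, w ∉ foot t
  · have hZT' : ∀ w ∈ Z ∪ T, w ∉ foot t := fun w hw => hW w (hZT hw)
    have hsub : explEvent ends X t ∩ sepFam ends W X = explEvent ends X t :=
      Set.inter_eq_left.mpr (fun ω hω => mem_sepFam_of_explEvent hω hW)
    have e : sepFam ends W X ∩ crossEvent ends (Z : Set V) (T : Set V) ∩
        explEvent ends X t = explEvent ends X t ∩ crossEvent ends (Z : Set V) (T : Set V) := by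
      ext ω
      simp only [Set.mem_inter_iff]
      constructor
      · rintro ⟨⟨_, hc⟩, ht⟩; exact ⟨ht, hc⟩
      · rintro ⟨ht, hc⟩; exact ⟨⟨mem_sepFam_of_explEvent ht hW, hc⟩, ht⟩
    rw [e, prob_explEvent_inter_cross ends p hZT', hsub]
  · simp only [not_forall, not_not] at hW
    obtain ⟨w, hw, hwt⟩ := hW
    have e1 : sepFam ends W X ∩ crossEvent ends (Z : Set V) (T : Set V) ∩
        explEvent ends X t = ∅ := by
      ext ω
      simp only [Set.mem_inter_iff, Set.mem_empty_iff_false, iff_false]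
      rintro ⟨⟨hS, _⟩, ht⟩
      exact not_mem_foot_of_sepFam ht hS hw hwt
    have e2 : explEvent ends X t ∩ sepFam ends W X = ∅ := by
      ext ω
      simp only [Set.mem_inter_iff, Set.mem_empty_iff_false, iff_false]
      rintro ⟨ht, hS⟩
      exact not_mem_foot_of_sepFam ht hS hw hwt
    rw [e1, e2, prob_empty, zero_mul]

/-- **(MONO)**: for disjoint `Z, T, X` and `v ∉ Z ∪ T ∪ X`, with `W = Z ∪ T`, `W' = W ∪ {v}`:
`P(W ↮ X) · P((Z ∪ {v}) ~ T ∧ W' ↮ X) ≥ P(Z ~ T ∧ W ↮ X) · P(W' ↮ X)`. -/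
theorem sep_fam_mono (hp01 : ∀ e, 0 < p e ∧ p e < 1) (Z T X : Finset V) (v : V)
    (hX : Disjoint ((Z ∪ T) ∪ {v}) X) :
    prob p (sepFam ends (Z ∪ T) X ∩ crossEvent ends (Z : Set V) (T : Set V)) *
      prob p (sepFam ends ((Z ∪ T) ∪ {v}) X) ≤
    prob p (sepFam ends (Z ∪ T) X) *
      prob p (sepFam ends ((Z ∪ T) ∪ {v}) X ∩
        crossEvent ends ((Z ∪ {v} : Finset V) : Set V) (T : Set V)) := by
  have hsub : Z ∪ T ⊆ (Z ∪ T) ∪ {v} := Finset.subset_union_left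
  -- (SHRINK) for the antitone `crossAway Z T`, through its negative
  have hmono : Monotone (fun t : X → Set V => -crossAway ends p Z T t) := by
    intro t t' h
    have := antitone_crossAway ends p hp01 Z T h
    show -crossAway ends p Z T t ≤ -crossAway ends p Z T t'
    linarith
  have H := sep_fam_shrink ends p hp01 hsub hX _ hmono
  -- the two expectations of `−crossAway` are the negatives of two crossing probabilities
  have neg_expect : ∀ (W : Finset V), expect p (fun ω =>
      (sepFam ends W X).indicator (fun _ => (1 : ℝ)) ω * (-crossAway ends p Z T (expl ends ω X))) =
      -expect p (fun ω => (sepFam ends W X).indicator (fun _ => (1 : ℝ)) ω *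
        crossAway ends p Z T (expl ends ω X)) := by
    intro W
    unfold expect
    rw [← Finset.sum_neg_distrib]
    apply Finset.sum_congr rfl
    intro ω _
    ring
  rw [neg_expect, neg_expect, ← prob_sepFam_inter_cross ends p Z T (Z ∪ T) X (le_refl _),
    ← prob_sepFam_inter_cross ends p Z T ((Z ∪ T) ∪ {v}) X hsub] at H
  -- `Z ~ T` implies `Z ∪ {v} ~ T`
  have hle : prob p (sepFam ends ((Z ∪ T) ∪ {v}) X ∩ crossEvent ends (Z : Set V) (T : Set V)) ≤
      prob p (sepFam ends ((Z ∪ T) ∪ {v}) X ∩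
        crossEvent ends ((Z ∪ {v} : Finset V) : Set V) (T : Set V)) := by
    apply prob_mono (isProbVec_of_interior p hp01)
    rintro ω ⟨hS, a, ha, b, hb, hc⟩
    exact ⟨hS, a, Finset.mem_coe.mpr (Finset.mem_union_left _ (Finset.mem_coe.mp ha)), b, hb, hc⟩
  have hS0 : 0 ≤ prob p (sepFam ends (Z ∪ T) X) :=
    prob_nonneg (isProbVec_of_interior p hp01) _
  nlinarith [mul_le_mul_of_nonneg_left hle hS0]

end FamilyMono

end SepPA

end Summit.Ventures.PercRepro2
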